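import Summits.BirchSwinnertonDyer.BirchSwinnertonDyer.Theorems.ManinLocalTwoThreeComplexAutExtension
import HarnessLib

/-!
# The fixed field of `Aut(ℂ/K)` is `K`, for every subfield `K ⊆ ℂ`
(route `ManinLocalTwoThree`, crux C2 `ManinOddAtFour` stmt-BirchSwinnertonDyer-22967; cell bsd-f2-manin, LEAD prover p1 gen 22;
`--supports stmt-BirchSwinnertonDyer-22967`)

WHY.  The cell's Galois statements (T-es-75 `optimalGamma1Parametrization_cuspInv_galoisAction`, theorem K, Kummer reciprocity) are
quantified over `σ : ℂ ≃ₐ[ℚ] ℂ`.  To read RATIONALITY out of them ("a complex number fixed by every `σ` that fixes `K` pointwise lies in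
`K`", e.g. Stevens 1982 Thm 1.3.1 (a): the cusp values are `ℚ(ζ_N)`-rational) one needs the fixed-field theorem for the huge group
`Aut(ℂ/K)`.  Proof: an algebraic `c ∉ K` is moved by an automorphism of the splitting field of its minimal polynomial, which extends to
`ℂ` (`ComplexAut.exists_complex_algEquiv_extends`, Steinitz); a transcendental `c` is part of a transcendence basis of `ℂ/K` and the
shift `c ↦ c + 1` of `K[basis]` extends to `ℂ` (uniqueness of algebraic closures) — the argument of
`Literature.AlgebraicGeometry.HodgeTheory.mem_range_algebraMap_of_forall_algEquiv`, run over a base that need not be algebraically closed.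

* `exists_algEquiv_apply_ne_of_transcendental` — a transcendental `c` is moved by some `τ ∈ Aut(ℂ/K)`;
* `exists_algEquiv_apply_ne_of_not_mem` — every `c ∉ K` is moved by some `σ ∈ Aut_ℚ(ℂ)` fixing `K` pointwise;
* `mem_of_forall_algEquiv` — **fixed field**: `(∀ σ : ℂ ≃ₐ[ℚ] ℂ, (∀ k ∈ K, σ k = k) → σ c = c) → c ∈ K`;
* `mem_adjoin_simple_of_forall_algEquiv` — the case `K = ℚ(a)`: fixed by every `σ` with `σ a = a` ⟹ `c ∈ ℚ⟮a⟯`.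

Pure field theory; nothing about C2, Manin's conjecture or BSD is proved here. [folklore]
-/

set_option autoImplicit false
-- lint-debt: the directory name repeats the summit name (sibling precedent `ManinLocalTwoThreeComplexAutExtension.lean`)
set_option linter.dupNamespace false

noncomputable section

open scoped Classical
open Polynomial

namespace Summit.BirchSwinnertonDyer.BirchSwinnertonDyer.Theorems.ManinLocalTwoThree.ComplexAut

/-! ## §1 Transcendental elements are moved -/

/-- The `K`-algebra automorphism of `MvPolynomial ι K` shifting one variable by `1` and fixing the others
(copy of `Literature.AlgebraicGeometry.HodgeTheory.exists_algEquiv_mvPolynomial_X_add_one`, to keep the imports light). [folklore] -/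
private theorem exists_algEquiv_mvPolynomial_X_add_one' {K : Type*} [Field K] (ι : Type*) (i₀ : ι) :
    ∃ ν : MvPolynomial ι K ≃ₐ[K] MvPolynomial ι K, ν (MvPolynomial.X i₀) = MvPolynomial.X i₀ + 1 := by
  classical
  let v : ι → MvPolynomial ι K := fun j ↦ if j = i₀ then MvPolynomial.X j + 1 else MvPolynomial.X j
  let v' : ι → MvPolynomial ι K := fun j ↦ if j = i₀ then MvPolynomial.X j - 1 else MvPolynomial.X j
  have h1 : (MvPolynomial.aeval v).comp (MvPolynomial.aeval v') = AlgHom.id K _ := by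
    refine MvPolynomial.algHom_ext fun j ↦ ?_
    by_cases hj : j = i₀
    · subst hj; simp [v, v']
    · simp [v, v', hj]
  have h2 : (MvPolynomial.aeval v').comp (MvPolynomial.aeval v) = AlgHom.id K _ := by
    refine MvPolynomial.algHom_ext fun j ↦ ?_
    by_cases hj : j = i₀
    · subst hj; simp [v, v']
    · simp [v, v', hj]
  exact ⟨AlgEquiv.ofAlgHom (MvPolynomial.aeval v) (MvPolynomial.aeval v') h1 h2, by simp [v]⟩

/-- **A transcendental element is moved by `Aut(ℂ/K)`**: if `c ∈ ℂ` is transcendental over the subfield `K`, some `K`-algebra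
automorphism of `ℂ` sends `c` to `c + 1` (adapted from `Literature.AlgebraicGeometry.HodgeTheory.mem_range_algebraMap_of_forall_algEquiv`:
extend `{c}` to a transcendence basis, shift, extend to the algebraic closure `ℂ` of `K[basis]`). [folklore] -/
theorem exists_algEquiv_apply_ne_of_transcendental {K : Type*} [Field K] [Algebra K ℂ] {c : ℂ} (ht : Transcendental K c) :
    ∃ τ : ℂ ≃ₐ[K] ℂ, τ c = c + 1 := by
  classical
  have hind : AlgebraicIndepOn K id ({c} : Set ℂ) := by
    rw [AlgebraicIndepOn, algebraicIndependent_singleton_iff (⟨c, Set.mem_singleton c⟩ : ({c} : Set ℂ))]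
    exact ht
  obtain ⟨t, hct, hbasis⟩ := exists_isTranscendenceBasis_superset hind
  have hc_mem : c ∈ t := hct (Set.mem_singleton c)
  set x : t → ℂ := Subtype.val with hx
  let i₀ : t := ⟨c, hc_mem⟩
  obtain ⟨ν, hν⟩ := exists_algEquiv_mvPolynomial_X_add_one' (K := K) t i₀
  let F := Algebra.adjoin K (Set.range x)
  haveI : IsAlgClosure F ℂ := IsAlgClosed.isAlgClosure_of_transcendence_basis x hbasis
  let e : F ≃ₐ[K] F := hbasis.1.aevalEquiv.symm.trans (ν.trans hbasis.1.aevalEquiv)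
  let τ₀ : ℂ ≃+* ℂ := IsAlgClosure.equivOfEquiv ℂ ℂ e.toRingEquiv
  have hτ₀ : ∀ s : F, τ₀ (algebraMap F ℂ s) = algebraMap F ℂ (e s) := fun s ↦
    IsAlgClosure.equivOfEquiv_algebraMap ℂ ℂ e.toRingEquiv s
  have hcomm : ∀ a : K, τ₀ (algebraMap K ℂ a) = algebraMap K ℂ a := by
    intro a
    rw [IsScalarTower.algebraMap_apply K F ℂ a, hτ₀, AlgEquiv.commutes]
  let τ : ℂ ≃ₐ[K] ℂ := AlgEquiv.ofRingEquiv (f := τ₀) hcomm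
  have hcF : algebraMap F ℂ (hbasis.1.aevalEquiv (MvPolynomial.X i₀)) = c := by
    rw [AlgebraicIndependent.algebraMap_aevalEquiv, MvPolynomial.aeval_X]
  refine ⟨τ, ?_⟩
  change τ₀ c = c + 1
  conv_lhs => rw [← hcF]
  rw [hτ₀]
  simp only [e, AlgEquiv.trans_apply, AlgEquiv.symm_apply_apply, hν, map_add, map_one]
  rw [AlgebraicIndependent.algebraMap_aevalEquiv, MvPolynomial.aeval_X]

/-! ## §2 Algebraic elements outside `K` are moved; the fixed field -/

/-- In a finite Galois extension an element fixed by every automorphism lies in the ground field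
(copy of `Literature.AlgebraicGeometry.Resolution.mem_bot_of_forall_algEquiv`). [folklore] -/
private theorem mem_bot_of_forall_algEquiv' {F E : Type*} [Field F] [Field E] [Algebra F E]
    [FiniteDimensional F E] [IsGalois F E] {x : E} (hx : ∀ θ : E ≃ₐ[F] E, θ x = x) :
    x ∈ (⊥ : IntermediateField F E) := by
  have h : IntermediateField.fixedField (⊤ : Subgroup (E ≃ₐ[F] E)) = ⊥ := by
    rw [← IntermediateField.fixingSubgroup_bot, IsGalois.fixedField_fixingSubgroup]
  rw [← h, IntermediateField.mem_fixedField_iff]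
  exact fun θ _ ↦ hx θ

/-- **Every `c ∉ K` is moved by some `σ ∈ Aut_ℚ(ℂ)` fixing `K` pointwise** (`K` any subfield of `ℂ`, as an intermediate field of `ℂ/ℚ`):
an algebraic `c` by an automorphism of the splitting field of `minpoly K c` inside `ℂ` (finite Galois over `K`) extended to `ℂ` by
`exists_complex_algEquiv_extends`; a transcendental `c` by `exists_algEquiv_apply_ne_of_transcendental`. [folklore] -/
theorem exists_algEquiv_apply_ne_of_not_mem (K : IntermediateField ℚ ℂ) {c : ℂ} (hcK : c ∉ K) :
    ∃ σ : ℂ ≃ₐ[ℚ] ℂ, (∀ k : K, σ k = k) ∧ σ c ≠ c := by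
  classical
  by_cases halg : IsAlgebraic K c
  · -- the splitting field of the minimal polynomial inside `ℂ`
    set p : K[X] := minpoly K c with hp
    have hint : IsIntegral K c := halg.isIntegral
    have hp0 : p ≠ 0 := minpoly.ne_zero hint
    have hsplit : (p.map (algebraMap K ℂ)).Splits := IsAlgClosed.splits _
    let M : IntermediateField K ℂ := IntermediateField.adjoin K (p.rootSet ℂ)
    haveI hSF : p.IsSplittingField K M := IntermediateField.adjoin_rootSet_isSplittingField hsplit
    haveI : Normal K M := Normal.of_isSplittingField p
    haveI : FiniteDimensional K M := Polynomial.IsSplittingField.finiteDimensional M p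
    haveI : Algebra.IsSeparable K M := Algebra.IsAlgebraic.isSeparable_of_perfectField
    haveI : IsGalois K M := IsGalois.mk
    have hcM : c ∈ M := IntermediateField.subset_adjoin K _ (by
      rw [Polynomial.mem_rootSet]; exact ⟨hp0, minpoly.aeval K c⟩)
    -- some automorphism of `M / K` moves `c`
    have hθ : ∃ θ : M ≃ₐ[K] M, θ ⟨c, hcM⟩ ≠ ⟨c, hcM⟩ := by
      by_contra h
      push Not at h
      have hbot := mem_bot_of_forall_algEquiv' h
      rw [IntermediateField.mem_bot] at hbot
      obtain ⟨k, hk⟩ := hbot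
      apply hcK
      have hkc : (k : ℂ) = c := by simpa using congrArg (fun m : M ↦ (m : ℂ)) hk
      rw [← hkc]
      exact k.2
    obtain ⟨θ, hθ⟩ := hθ
    -- extend to `ℂ`
    obtain ⟨σ, hσ⟩ := exists_complex_algEquiv_extends (M.restrictScalars ℚ) (θ.restrictScalars ℚ)
    refine ⟨σ, fun k ↦ ?_, fun h ↦ hθ ?_⟩
    · have hkM : (k : ℂ) ∈ M.restrictScalars ℚ := (algebraMap K M k).2
      have h1 := hσ ⟨k, hkM⟩
      have h2 : θ ⟨(k : ℂ), hkM⟩ = ⟨(k : ℂ), hkM⟩ := by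
        have e : (⟨(k : ℂ), hkM⟩ : M) = algebraMap K M k := rfl
        rw [e, AlgEquiv.commutes]
      have h3 : ((θ.restrictScalars ℚ) ⟨(k : ℂ), hkM⟩ : ℂ) = k := by
        rw [AlgEquiv.restrictScalars_apply, h2]
      exact h1.trans h3
    · have h1 := hσ ⟨c, hcM⟩
      apply Subtype.ext
      calc ((θ ⟨c, hcM⟩ : M) : ℂ) = ((θ.restrictScalars ℚ ⟨c, hcM⟩ : M) : ℂ) := rfl
        _ = σ c := h1.symm
        _ = c := h
  · -- transcendental
    obtain ⟨τ, hτ⟩ := exists_algEquiv_apply_ne_of_transcendental (K := K) halg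
    refine ⟨τ.restrictScalars ℚ, fun k ↦ ?_, ?_⟩
    · rw [AlgEquiv.restrictScalars_apply]
      exact τ.commutes k
    · rw [AlgEquiv.restrictScalars_apply, hτ]
      simp

/-- **The fixed field of `Aut(ℂ/K)` is `K`**: a complex number fixed by every `ℚ`-algebra automorphism of `ℂ` that fixes the subfield `K`
pointwise lies in `K`. [folklore] -/
theorem mem_of_forall_algEquiv (K : IntermediateField ℚ ℂ) {c : ℂ}
    (hc : ∀ σ : ℂ ≃ₐ[ℚ] ℂ, (∀ k : K, σ k = k) → σ c = c) : c ∈ K := by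
  by_contra hcK
  obtain ⟨σ, hσK, hσc⟩ := exists_algEquiv_apply_ne_of_not_mem K hcK
  exact hσc (hc σ hσK)

/-- **The case `K = ℚ(a)`**: a complex number fixed by every `σ ∈ Aut_ℚ(ℂ)` with `σ a = a` lies in `ℚ⟮a⟯`. [folklore] -/
theorem mem_adjoin_simple_of_forall_algEquiv (a : ℂ) {c : ℂ}
    (hc : ∀ σ : ℂ ≃ₐ[ℚ] ℂ, σ a = a → σ c = c) : c ∈ IntermediateField.adjoin ℚ ({a} : Set ℂ) := by
  refine mem_of_forall_algEquiv _ fun σ hσ ↦ hc σ ?_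
  exact hσ ⟨a, IntermediateField.subset_adjoin ℚ _ (Set.mem_singleton a)⟩

end Summit.BirchSwinnertonDyer.BirchSwinnertonDyer.Theorems.ManinLocalTwoThree.ComplexAut

end
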